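import Literature.AlgebraicGeometry.HodgeTheory.IntegralLefschetzOneOne
import Summits.HodgeConjecture.HodgeConjecture.Theses.GenericDivisibility

/-!
# Route GenericDivisibility — crux `HodgeClassesGenericallyDivisible` (C1, item stmt-HodgeConjecture-18466):
# the surface case `p = 1`, UNCONDITIONALLY

The companions `Theorems/GenericDivisibilityHodgeClassesGenericallyDivisibleFinite` and
`Theorems/GenericDivisibilityHodgeClassesGenericallyDivisibleSurface` settle the `p = 1` sector of the
crux only behind the route's support item `TorsionDiesGenerically` (Colliot-Thélène–Voisin 2012,
Thm. 3.1): the tree's Lefschetz theorem on `(1,1)`-classes is RATIONAL (`N¹ = F¹ ∩ H²(X; ℚ)`), hence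
blind to torsion, and what was left was exactly "a torsion class on a Zariski open dies on a smaller
open" — the item itself at `p = 1`.

This file removes that input.  The tree now proves the Lefschetz theorem on `(1,1)`-classes with
INTEGRAL coefficients in its Zariski-local form
(`Literature.AlgebraicGeometry.HodgeTheory.integralLefschetzOneOne`, file
`HodgeTheory/IntegralLefschetzOneOne`): for `X` smooth projective over `ℂ` and `z ∈ H²(X(ℂ); ℤ)` whose
complexification is of Hodge type `(1,1)` — torsion classes included — there is a Zariski-closed
`Z ≠ X` with `z|_{(X ∖ Z)(ℂ)} = 0` in `H²((X ∖ Z)(ℂ); ℤ)` (Voisin I, Thm. 11.30 with Rem. 7.9 and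
Thm. 11.33: the exponential cocycle of `z`, built from an integer Čech cocycle of `z` on a chart-convex
cover, presents a holomorphic line bundle; Kodaira–Serre sections trivialise it off a proper closed
analytic subset, algebraic by Chow; and the integer Čech class of an exponential cocycle which is a
coboundary of continuous units dies, by winding cochains).  Hence:

* `hodgeClassesGenericallyDivisible_one_unconditional` — **C1 at `p = 1` holds outright**: on a smooth
  projective complex surface an integral class with `(1,1)` complexification is `m • 0` on the complex
  points of a non-empty Zariski open, for every `m ≥ 1`.
* `stub_hodgeClassesGenericallyDivisible_one_unconditional` — the registered sub-goal of the item of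
  that name: the item's statement with `p` specialised to `1`, verbatim, no hypothesis.

The crux itself (all `p ≥ 1`) is untouched: for `p ≥ 2` it is of Hodge-conjecture strength
(`Theorems/GenericDivisibilityHodgeClassesGenericallyDivisible`).

References: C. Voisin, *Hodge Theory and Complex Algebraic Geometry I* (2002), Thm. 11.30, Rem. 7.9,
Thm. 11.33 [VoisinHodgeI2002]; J.-P. Serre, GAGA, Ann. Inst. Fourier 6 (1956), §19 Prop. 13 and
n° 16–17 [SerreGAGA1956].
-/

-- `Summit.HodgeConjecture.HodgeConjecture.Theorems` is the mandated namespace (single-problem summit: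
-- Problem = Summit), which `linter.dupNamespace` flags on every declaration; the lakefile turns the
-- linter off tree-wide (weak option), restated here so stand-alone elaboration is warning-free too.
set_option linter.dupNamespace false

noncomputable section

namespace Summit.HodgeConjecture.HodgeConjecture.Theorems

open Literature.AlgebraicGeometry.Motives Literature.AlgebraicGeometry.HodgeTheory
  Literature.AlgebraicTopology.SingularHomology
open Summit.HodgeConjecture.HodgeConjecture.Theses.GenericDivisibility

/-- **C1 at `p = 1`, unconditionally.** For `X` a smooth projective complex surface,
`z ∈ H²(X(ℂ); ℤ)` with `(1,1)` complexification and every `m ≥ 1`, there are a proper Zariski-closed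
`Z` and `y` (namely `0`) on `(X ∖ Z)(ℂ)` with `m • y = z|_{(X ∖ Z)(ℂ)}`: the integral Lefschetz
theorem on `(1,1)`-classes in Zariski-local form (`integralLefschetzOneOne`) kills `z` on a non-empty
Zariski open. [cite: VoisinHodgeI2002, Thm. 11.30, Rem. 7.9, Thm. 11.33]
[cite: SerreGAGA1956, §19 Prop. 13] -/
theorem hodgeClassesGenericallyDivisible_one_unconditional
    ⦃X : SchemeOver ℂ⦄ (hX : IsSmoothProjective (2 * 1) X)
    (z : singularCohomology ℤ ℤ (ComplexPoints X) (2 * 1))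
    (hz : IsOfHodgeType (2 * 1) X (2 * 1) 1 1
      (singularCohomology.ringChange (Int.castRingHom ℂ) (ComplexPoints X) (2 * 1) z))
    (m : ℕ) :
    ∃ Z : Set X.left, IsClosed Z ∧ Z ≠ Set.univ ∧
      ∃ y : singularCohomology ℤ ℤ (complexPointsCompl X Z) (2 * 1),
        m • y = singularCohomology.map ℤ ℤ
          (⟨Subtype.val, continuous_subtype_val⟩ : C(complexPointsCompl X Z, ComplexPoints X))
          (2 * 1) z := by
  obtain ⟨Z, hZ, hZne, h0⟩ := integralLefschetzOneOne hX z hz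
  exact ⟨Z, hZ, hZne, 0, by rw [smul_zero]; exact h0.symm⟩

/-- **Registered sub-goal `stub_hodgeClassesGenericallyDivisible_one_unconditional` of the crux item
stmt-HodgeConjecture-18466** — its `p = 1` sector with NO hypothesis: the item's statement with `p`
specialised to `1`, verbatim; the proof is `hodgeClassesGenericallyDivisible_one_unconditional`
(integral Lefschetz `(1,1)`). [cite: VoisinHodgeI2002, Thm. 11.30, Rem. 7.9, Thm. 11.33]
[cite: SerreGAGA1956, §19 Prop. 13] -/
theorem stub_hodgeClassesGenericallyDivisible_one_unconditional :
    ∀ ⦃X : SchemeOver ℂ⦄, IsSmoothProjective (2 * 1) X →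
      ∀ z : singularCohomology ℤ ℤ (ComplexPoints X) (2 * 1),
        IsOfHodgeType (2 * 1) X (2 * 1) 1 1
          (singularCohomology.ringChange (Int.castRingHom ℂ) (ComplexPoints X) (2 * 1) z) →
        ∀ m : ℕ, 1 ≤ m → ∃ Z : Set X.left, IsClosed Z ∧ Z ≠ Set.univ ∧
          ∃ y : singularCohomology ℤ ℤ (complexPointsCompl X Z) (2 * 1),
            m • y = singularCohomology.map ℤ ℤ
              (⟨Subtype.val, continuous_subtype_val⟩ : C(complexPointsCompl X Z, ComplexPoints X))
              (2 * 1) z :=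
  fun _ hX z hz m _ ↦ hodgeClassesGenericallyDivisible_one_unconditional hX z hz m

end Summit.HodgeConjecture.HodgeConjecture.Theorems
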